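import Summits.HodgeConjecture.HodgeConjecture.Theorems.CyclicUnitaryPowersGenericCyclicSurfacePowersHodge
import Literature.AlgebraicGeometry.HodgeTheory.HodgeLociDichotomyOfWeightTwoFrames
import Literature.AlgebraicGeometry.Motives.SpecialisedHypersurfaceFamilyFibreImmersion
import HarnessLib

/-!
# Route CyclicUnitaryPowers — the analytic K1-A and the analytic rung leaf off a MEAGRE set, with Griffiths' named
# fact REPLACED by holomorphic frames of `F² = H^{2,0}` of the Carlson–Toledo family

Support file for `stmt-HodgeConjecture-19544` (`--supports`; CONDITIONAL results, nothing here closes an item).  Prover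
seat `hodge-nonav-20241-p1` (g17, cell hodge-nonav), brick «F-H modulo hF2» of prover-Ax's programme «B4 RELATIVE RESIDUES».

`CyclicUnitaryPowersGenericCyclicSurfacePowersHodge` (prover-Ax g11) proves, for every prime `p ≥ 7`, the clauses
`Deck ∧ Comm` of crux K1-A and `HodgeConjectureFor (2(k+1)) Y` for all self fibre powers `Y` of EVERY smooth projective
surface `X ⊂ ℙ³` cut out by `x₃^p − f` with `f` off a MEAGRE subset of the coefficient space — CONDITIONAL on the ONE
named fact `Griffiths1968_holomorphicHodgeSubbundles` (Voisin I Thm. 10.3: holomorphy of all Hodge bundles).  The tree now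
reduces that input, for families of SURFACES with a fibrewise projective embedding, to holomorphic frames of the TOP Hodge
bundle `F²𝓗² = 𝓗^{2,0}` alone (`exists_isMeagre_isHodgeGenericPoint_of_weightTwoFrames`,
`HodgeLociDichotomyOfWeightTwoFrames`: first Hodge–Riemann relation for a flat polarization + identity principle), and the
fibres of the Carlson–Toledo family `cyclicCoverFamily p = familySpz ℂ 2 p (cyclicCoverSpz p)` embed in `ℙ³` through the
total space (`isClosedImmersion_fiberι_familySpz_toProjectiveSpace`).  This file re-runs §1–§3 of the g11 file with `hG`
replaced by that frame hypothesis `hF2` (to be DISCHARGED by the relative Griffiths residues `Res(PΩ/F_t)`, programme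
bricks FF1–FF4):

* `exists_isMeagre_isHodgeGenericPoint_cyclicCoverFamily_of_weightTwoFrames` — §1: the meagre exceptional set of
  coefficient vectors, from `hF2` for the given models;
* `exists_deck_comm_offMeagre_of_weightTwoFrames` — §2: analytic K1-A from `hF2` (for all Hodge-symmetric models);
* `cyclicSurfacePowersHodge_offMeagre_of_weightTwoFrames` — §3: the analytic leaf from `hF2`.

HONEST FRAMING: CONDITIONAL on the displayed hypothesis `hF2`; items 19544 ∕ 19543 stay OPEN; rung F-H1 is not moved;
nothing here says HC ∕ HC_CM ∕ HC_AV is proved.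

## References
* [Deligne1972WeilK3] P. Deligne, La conjecture de Weil pour les surfaces K3, Invent. Math. 15 (1972), Prop. 7.5.
* [Andre1992] Y. André, Mumford–Tate groups of mixed Hodge structures …, Compositio Math. 82 (1992), §4 Lemma 4, §5 Thm. 1.
* [VoisinHodgeI2002] C. Voisin, Hodge Theory and Complex Algebraic Geometry I, CUP 2002, §7.1.2, §10.2.1 Thm. 10.3.
* [VoisinHodgeII2003] C. Voisin, Hodge Theory and Complex Algebraic Geometry II, CUP 2003, §5.3.1 Lemma 5.13.
* [CarlsonToledo1999] J. A. Carlson, D. Toledo, Duke Math. J. 97 (1999), §§2, 5, 6, 7 (Thm. 7.1).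
-/

noncomputable section

set_option linter.dupNamespace false

namespace Summit.HodgeConjecture.HodgeConjecture.Theorems.CyclicUnitaryPowersGenericCyclicSurfacePowersHodge

open Literature.AlgebraicGeometry.Motives Literature.AlgebraicGeometry.HodgeTheory
open Literature.AlgebraicGeometry.HodgeTheory.BettiUniverse
open Literature.AlgebraicGeometry.Motives.UniversalHypersurface Literature.AlgebraicGeometry.HodgeTheory.UniversalHypersurface
open Literature.AlgebraicTopology.SingularHomology
open CategoryTheory CategoryTheory.Limits _root_.Topology _root_.Filter
open scoped TensorProduct
open Summit.HodgeConjecture.HodgeConjecture.Theorems.CyclicUnitaryPowersHodgeGenericDeckCommutators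
open Summit.HodgeConjecture.HodgeConjecture.Theorems.CyclicUnitaryPowersNodalMeridianMonodromy

/-- `F2Frames[p, A, hA]`: the `F²`-FRAME HYPOTHESIS for the Carlson–Toledo family `cyclicCoverFamily p` and the fibre
models `A` — VERBATIM the binder `hF2` of `hodgeLociDichotomy_of_weightTwoFrames` ∕
`exists_isMeagre_isHodgeGenericPoint_of_weightTwoFrames` with `f := cyclicCoverFamily p`,
`hU := cyclicCoverFamily_locallyTrivial p`, `hf := isSmoothProjectiveFamily_cyclicCoverFamily p` and chart dimension
`0 + Nat.card (TernaryIndex p)` (= `smoothOfRelativeDimension_baseSpz_hom`). Local notation only. -/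
local notation3 (prettyPrint := false) "F2Frames[" p ", " A ", " hA "]" =>
  (∀ (s t₁ : (Set.univ : Set (ComplexPoints (cyclicCoverBase p)))), ∀ N ∈ 𝓝 t₁,
    ∀ (T₁ : singularCohomology ℚ ℚ (ComplexPoints (fiberOver (cyclicCoverFamily p) s.1)) 2 ≃ₗ[ℚ]
      singularCohomology ℚ ℚ (ComplexPoints (fiberOver (cyclicCoverFamily p) t₁.1)) 2),
    (∃ δ₁ : Path.Homotopic.Quotient s t₁,
      ∀ v, ofRatClass _ 2 (T₁ v) =
        transportFun (cyclicCoverFamily p) 2 (cyclicCoverFamily_locallyTrivial p) δ₁ (ofRatClass _ 2 v)) →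
    ∃ W₀ : Set (Set.univ : Set (ComplexPoints (cyclicCoverBase p))), IsOpen W₀ ∧ t₁ ∈ W₀ ∧ W₀ ⊆ N ∧
      IsPathConnected W₀ ∧
    ∃ ψ : OpenPartialHomeomorph (Set.univ : Set (ComplexPoints (cyclicCoverBase p)))
      (Fin (0 + Nat.card (TernaryIndex p)) → ℂ), W₀ ⊆ ψ.source ∧
    ∃ (r₂ : ℕ) (w₂ : Fin r₂ → Set.Elem (Set.univ : Set (ComplexPoints (cyclicCoverBase p))) →
      ℂ ⊗[ℚ] singularCohomology ℚ ℚ (ComplexPoints (fiberOver (cyclicCoverFamily p) s.1)) 2),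
      (∀ t ∈ W₀, ∀ (ε' : Path t₁ t), (∀ r', ε' r' ∈ W₀) →
        ∀ (T : singularCohomology ℚ ℚ (ComplexPoints (fiberOver (cyclicCoverFamily p) s.1)) 2 ≃ₗ[ℚ]
          singularCohomology ℚ ℚ (ComplexPoints (fiberOver (cyclicCoverFamily p) t.1)) 2),
        (∀ v, ofRatClass _ 2 (T v) =
          transportFun (cyclicCoverFamily p) 2 (cyclicCoverFamily_locallyTrivial p) ⟦ε'⟧ (ofRatClass _ 2 (T₁ v))) →
        LinearIndependent ℂ (fun i ↦ w₂ i t) ∧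
          (((A t.1).hodgeStructure ((isSmoothProjectiveFamily_cyclicCoverFamily p).isSmoothProjective t.1)
            (hA t.1) 2).comapEquiv T).F 2 = Submodule.span ℂ (Set.range fun i ↦ w₂ i t)) ∧
      (∀ (i : Fin r₂) (φ : Module.Dual ℂ
          (ℂ ⊗[ℚ] singularCohomology ℚ ℚ (ComplexPoints (fiberOver (cyclicCoverFamily p) s.1)) 2)),
        AnalyticOnNhd ℂ (fun z ↦ φ (w₂ i (ψ.symm z))) (ψ '' W₀)))

/-! ### §1 The meagre exceptional set of coefficient vectors, from `F²`-frames -/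

/-- **The meagre exceptional set, from holomorphic `F²`-frames** (§1 of the g11 file with Griffiths' named fact replaced
by `hF2`): for `p ≥ 2`, Hodge-symmetric models `A` and `hF2 : F2Frames[p, A, hA]`, there is a meagre
`M ⊆ ℂ^{TernaryIndex p}`, containing `0`, off which the classifying point of every `f` with smooth model is Hodge generic
(`exists_isMeagre_isHodgeGenericPoint_of_weightTwoFrames` with `ε := (𝒳_φ → 𝒴 → ℙ³)`, fibrewise a closed immersion by
`isClosedImmersion_fiberι_familySpz_toProjectiveSpace`). [cite: Deligne1972WeilK3, Prop. 7.5]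
[cite: VoisinHodgeII2003, §5.3.1 Lemma 5.13] [cite: CarlsonToledo1999, §2] -/
theorem exists_isMeagre_isHodgeGenericPoint_cyclicCoverFamily_of_weightTwoFrames (p : ℕ) [NeZero p]
    (A : ∀ t : ComplexPoints (cyclicCoverBase p), HodgeModel 2 (fiberOver (cyclicCoverFamily p) t))
    (hA : ∀ t, (A t).IsHodgeSymmetric) (hF2 : F2Frames[p, A, hA]) :
    ∃ M : Set (TernaryIndex p → ℂ), IsMeagre M ∧ (0 : TernaryIndex p → ℂ) ∈ M ∧
      ∀ f : MvPolynomial (Fin 3) ℂ, f.IsHomogeneous p →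
        SmoothHypersurface.IsNonsingularForm ℂ (cyclicCoverForm p f) →
        (fun d : TernaryIndex p => f.coeff d.1) ∉ M →
        haveI : HodgeTensorFacts.{0, 0} := hodgeTensorFacts_holds
        haveI : ∀ t : ComplexPoints (cyclicCoverBase p),
            Module.Finite ℚ (bettiCohomology (fiberOver (cyclicCoverFamily p) t) 2) :=
          fun t => finite ((isSmoothProjectiveFamily_cyclicCoverFamily p).isSmoothProjective t) 2
        IsHodgeGenericPoint (cyclicCoverFamily p) 2 (cyclicCoverFamily_locallyTrivial p)
          (isSmoothProjectiveFamily_cyclicCoverFamily p) A hA ⟨cyclicCoverPoint p f, Set.mem_univ _⟩ := by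
  haveI : HodgeTensorFacts.{0, 0} := hodgeTensorFacts_holds
  haveI : ∀ t : ComplexPoints (cyclicCoverBase p),
      Module.Finite ℚ (bettiCohomology (fiberOver (cyclicCoverFamily p) t) 2) :=
    fun t => finite ((isSmoothProjectiveFamily_cyclicCoverFamily p).isSmoothProjective t) 2
  haveI := smoothOfRelativeDimension_baseSpz_hom ℂ 2 p (cyclicCoverSpz p)
  obtain ⟨MS, hMS, hgen⟩ := exists_isMeagre_isHodgeGenericPoint_of_weightTwoFrames (cyclicCoverFamily p)
    (0 + Nat.card (TernaryIndex p)) (isSmoothProjectiveFamily_cyclicCoverFamily p)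
    (isQuasiProjectiveOver_baseSpz 2 p (cyclicCoverSpz p)) (cyclicCoverFamily_locallyTrivial p) A hA
    (show 1 ≤ 2 + 1 by norm_num)
    (totalSpzToTotal ℂ 2 p (cyclicCoverSpz p) ≫ toProjectiveSpace ℂ 2 p)
    (isClosedImmersion_fiberι_familySpz_toProjectiveSpace ℂ 2 p (cyclicCoverSpz p)) hF2
  let χ : ComplexPoints (cyclicCoverBase p) → (TernaryIndex p → ℂ) := fun t e => (branchForm p t).coeff e.1
  refine ⟨χ '' MS ∪ {0}, ((isEmbedding_coeffChart p).isInducing.isMeagre_image hMS).union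
    (isMeagre_singleton_zero p), Or.inr rfl, fun f hf hJ hfM => hgen _ fun hmem => hfM (Or.inl ?_)⟩
  exact ⟨cyclicCoverPoint p f, hmem, funext fun e => coeffChart_cyclicCoverPoint hf hJ e⟩

/-! ### §2 Analytic K1-A from `F²`-frames -/

/-- **Analytic K1-A from holomorphic `F²`-frames** (§2 of the g11 file with `hG` ↦ `hF2` for ALL Hodge-symmetric models):
for every prime `p ≥ 7` a meagre `M` such that every `f` homogeneous of degree `p` with coefficient vector off `M` and
every smooth projective `X ⊂ ℙ³` cut out by `x₃^p − f` carry `σ : X ⟶ X` with the route's clauses `Deck ∧ Comm`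
(verbatim the `let`-block of the route decl `VeryGeneralDeckCommutatorsInHg`). CONDITIONAL on `hF2`.
[cite: Deligne1972WeilK3, Prop. 7.5] [cite: Andre1992, §4 Lemma 4 and §5 Thm. 1]
[cite: CarlsonToledo1999, §6 (kdoublept) and §7 Theorem 7.1] [cite: VoisinHodgeII2003, §5.3.1 Lemma 5.13] -/
theorem exists_deck_comm_offMeagre_of_weightTwoFrames
    (hF2 : ∀ (p : ℕ) [NeZero p]
      (A : ∀ t : ComplexPoints (cyclicCoverBase p), HodgeModel 2 (fiberOver (cyclicCoverFamily p) t))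
      (hA : ∀ t, (A t).IsHodgeSymmetric), F2Frames[p, A, hA]) :
    open Literature.AlgebraicGeometry.Motives Literature.AlgebraicGeometry.HodgeTheory Literature.AlgebraicGeometry.HodgeTheory.BettiUniverse CategoryTheory.Limits in let pmul : List ℕ → List ℕ → List ℕ := fun a b => (List.range (a.length + b.length - 1)).map fun k => ((List.range (k + 1)).map fun i => a.getD i 0 * b.getD (k - i) 0).sum; let ehn : ℕ → ℕ → ℕ → ℕ := fun p j q => if (q + 1) * p < 3 + j then 0 else ((List.replicate 3 (List.replicate (p - 1) 1)).foldl pmul [1]).getD ((q + 1) * p - 3 - j) 0; let Deck : (p : ℕ) → (X : SchemeOver ℂ) → IsSmoothProjective 2 X → (X ⟶ X) → Prop := fun p X hX σ => pull σ 2 ^ p = 1 ∧ (∀ x y, tr hX (2 + 2) (cup X 2 2 (pull σ 2 x) (pull σ 2 y)) = tr hX (2 + 2) (cup X 2 2 x y)) ∧ Module.finrank ℚ ↥(Module.End.eigenspace (pull σ 2) 1) = 1 ∧ ∃ ζ : ℂ, IsPrimitiveRoot ζ p ∧ ∀ j q : ℕ, 1 ≤ j → j < p → q ≤ 2 → Module.finrank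 ℂ ↥(Module.End.eigenspace ((pull σ 2).baseChange ℂ) (ζ ^ j) ⊓ (hodge exists_isReal_hodgeModel_holds hX 2).piece ((2 : ℤ) - q) q) = ehn p j q; let Uni : (X : SchemeOver ℂ) → IsSmoothProjective 2 X → (X ⟶ X) → (bettiCohomology X 2 ≃ₗ[ℚ] bettiCohomology X 2) → Prop := fun X hX σ g => (∀ x, g (pull σ 2 x) = pull σ 2 (g x)) ∧ ∀ x y, tr hX (2 + 2) (cup X 2 2 (g x) (g y)) = tr hX (2 + 2) (cup X 2 2 x y); let Comm : (X : SchemeOver ℂ) → IsSmoothProjective 2 X → (X ⟶ X) → Prop := fun X hX σ => haveI := finite hX 2; haveI : HodgeTensorFacts.{0, 0} := hodgeTensorFacts_holds; ∀ g h : bettiCohomology X 2 ≃ₗ[ℚ] bettiCohomology X 2, Uni X hX σ g → Uni X hX σ h → g * h * g⁻¹ * h⁻¹ ∈ (hodge exists_isReal_hodgeModel_holds hX 2).hodgeGroup; ∀ ⦃p : ℕ⦄, p.Prime → 7 ≤ p → ∃ M : Set ({d : Fin 3 →₀ ℕ // d.degree = p} → ℂ), IsMeagre M ∧ ∀ f :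 MvPolynomial (Fin 3) ℂ, f.IsHomogeneous p → (fun d : {d : Fin 3 →₀ ℕ // d.degree = p} => f.coeff d.1) ∉ M → ∀ ⦃X : SchemeOver ℂ⦄ (hX : IsSmoothProjective 2 X), IsHypersurfaceCutOutBy 3 (MvPolynomial.X (Fin.last 3) ^ p - MvPolynomial.rename Fin.castSucc f) X → ∃ σ : X ⟶ X, Deck p X hX σ ∧ Comm X hX σ := by
  intro pmul ehn Deck Uni Comm p hp h7
  haveI : NeZero p := ⟨hp.ne_zero⟩
  have hp2 : 2 ≤ p := by omega
  -- real (hence Hodge-symmetric) Hodge models of the fibres of the Carlson–Toledo family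
  have hAm := fun t : ComplexPoints (cyclicCoverBase p) =>
    exists_isReal_hodgeModel_holds.exists_isHodgeSymmetric
      ((isSmoothProjectiveFamily_cyclicCoverFamily p).isSmoothProjective t)
  let A : ∀ t : ComplexPoints (cyclicCoverBase p), HodgeModel 2 (fiberOver (cyclicCoverFamily p) t) :=
    fun t => (hAm t).choose
  have hA : ∀ t, (A t).IsHodgeSymmetric := fun t => (hAm t).choose_spec
  obtain ⟨M, hM, h0M, hgen⟩ :=
    exists_isMeagre_isHodgeGenericPoint_cyclicCoverFamily_of_weightTwoFrames p A hA (hF2 p A hA)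
  refine ⟨M, hM, fun f hf hfM X hX hcut => ?_⟩
  have hf0 : f ≠ 0 := by
    intro h
    apply hfM
    have : (fun d : TernaryIndex p => f.coeff d.1) = 0 := funext fun d => by rw [h, MvPolynomial.coeff_zero]; rfl
    rw [this]
    exact h0M
  obtain ⟨e⟩ := hcut.nonempty_iso_hypersurface
  have hXF : IsSmoothProjective 2 (SmoothHypersurface.hypersurface
      (MvPolynomial.X (Fin.last 3) ^ p - MvPolynomial.rename Fin.castSucc f)) := hX.of_iso e
  have hJ : SmoothHypersurface.IsNonsingularForm ℂ (cyclicCoverForm p f) :=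
    CyclicCoverFormNonsingular.isNonsingularForm_cyclicCoverForm_of_isSmoothProjective hp2 hf hf0 hXF
  exact exists_deck_comm_of_hodgeGeneric_of_localMonodromyBound
    carlsonToledo1999_nodalMeridianLocalMonodromyBound_holds hp h7 f hf hf0 hXF A hA (hgen f hf hJ hfM) hX hcut

/-! ### §3 The analytic leaf from `F²`-frames -/

/-- **Analytic rung-F-H1 leaf from holomorphic `F²`-frames** (§3 of the g11 file with `hG` ↦ `hF2` for ALL Hodge-symmetric
models): for every prime `p ≥ 7` a MEAGRE subset `M` of the coefficient space `ℂ^{TernaryIndex p}` such that for every `f`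
homogeneous of degree `p` with coefficient vector off `M`, every smooth projective surface `X ⊂ ℙ³` cut out by `x₃^p − f`
and every `(k+1)`-fold self fibre power `Y` of `X`: `HodgeConjectureFor (2(k+1)) Y`.  CONDITIONAL on `hF2` (relative
Griffiths residues, programme B4); items stay open; rung F-H1 not moved; HC not proved. [cite: Deligne1972WeilK3, Prop. 7.5]
[cite: Andre1992, §4 Lemma 4 and §5 Thm. 1] [cite: CarlsonToledo1999, §6 (kdoublept) and §7 Theorem 7.1]
[cite: VoisinHodgeII2003, §5.3.1 Lemma 5.13] -/
theorem cyclicSurfacePowersHodge_offMeagre_of_weightTwoFrames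
    (hF2 : ∀ (p : ℕ) [NeZero p]
      (A : ∀ t : ComplexPoints (cyclicCoverBase p), HodgeModel 2 (fiberOver (cyclicCoverFamily p) t))
      (hA : ∀ t, (A t).IsHodgeSymmetric), F2Frames[p, A, hA]) :
    ∀ ⦃p : ℕ⦄, p.Prime → 7 ≤ p → ∃ M : Set ({d : Fin 3 →₀ ℕ // d.degree = p} → ℂ), IsMeagre M ∧
      ∀ f : MvPolynomial (Fin 3) ℂ, f.IsHomogeneous p →
        (fun d : {d : Fin 3 →₀ ℕ // d.degree = p} => f.coeff d.1) ∉ M →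
        ∀ ⦃X : SchemeOver ℂ⦄, IsSmoothProjective 2 X →
          IsHypersurfaceCutOutBy 3 (MvPolynomial.X (Fin.last 3) ^ p - MvPolynomial.rename Fin.castSucc f) X →
          ∀ ⦃k : ℕ⦄ ⦃Y : SchemeOver ℂ⦄, (∃ π : Fin (k + 1) → (Y ⟶ X), Nonempty (IsLimit (Fan.mk Y π))) →
            HodgeConjectureFor (2 * (k + 1)) Y := by
  intro p hp h7
  haveI : NeZero p := ⟨hp.ne_zero⟩
  have hp2 : 2 ≤ p := by omega
  have hAm := fun t : ComplexPoints (cyclicCoverBase p) =>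
    exists_isReal_hodgeModel_holds.exists_isHodgeSymmetric
      ((isSmoothProjectiveFamily_cyclicCoverFamily p).isSmoothProjective t)
  let A : ∀ t : ComplexPoints (cyclicCoverBase p), HodgeModel 2 (fiberOver (cyclicCoverFamily p) t) :=
    fun t => (hAm t).choose
  have hA : ∀ t, (A t).IsHodgeSymmetric := fun t => (hAm t).choose_spec
  obtain ⟨M, hM, h0M, hgen⟩ :=
    exists_isMeagre_isHodgeGenericPoint_cyclicCoverFamily_of_weightTwoFrames p A hA (hF2 p A hA)
  refine ⟨M, hM, fun f hf hfM X hX hcut k Y hY => ?_⟩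
  have hf0 : f ≠ 0 := by
    intro h
    apply hfM
    have : (fun d : TernaryIndex p => f.coeff d.1) = 0 := funext fun d => by rw [h, MvPolynomial.coeff_zero]; rfl
    rw [this]
    exact h0M
  obtain ⟨e⟩ := hcut.nonempty_iso_hypersurface
  have hXF : IsSmoothProjective 2 (SmoothHypersurface.hypersurface
      (MvPolynomial.X (Fin.last 3) ^ p - MvPolynomial.rename Fin.castSucc f)) := hX.of_iso e
  have hJ : SmoothHypersurface.IsNonsingularForm ℂ (cyclicCoverForm p f) :=
    CyclicCoverFormNonsingular.isNonsingularForm_cyclicCoverForm_of_isSmoothProjective hp2 hf hf0 hXF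
  exact hodgeConjectureFor_powers_of_hodgeGeneric_of_localMonodromyBound
    carlsonToledo1999_nodalMeridianLocalMonodromyBound_holds hp h7 f hf hf0 hXF A hA (hgen f hf hJ hfM) hX hcut hY

end Summit.HodgeConjecture.HodgeConjecture.Theorems.CyclicUnitaryPowersGenericCyclicSurfacePowersHodge

end
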